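import Mathlib.LinearAlgebra.Matrix.NonsingularInverse
import Mathlib.LinearAlgebra.Matrix.PosDef
import HarnessLib

/-!
# Deflation (coarse-grid) projectors of a linear system: the little operator, `π_L`, `π_R`,
# the exact splitting of `D z = b`, and `Γ₅`-compatible aggregation

Topic `LinearAlgebra/Matrix`.  PUBLISHED RESULTS with our proofs; no named fact (`def … : Prop`)
is introduced (D-0026).  Wanted by the cell pub-lqcd (venture `LatticeQCDFlow`; HOME/R2-SCOPE.md
§1 "a solve", §3 E5/E7 and §4 cost classes — what one solve of the Dirac equation costs and how
low-mode deflation / a coarse grid changes it; FANOUT row 38); sequel of the tree's conjugate-gradient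
thread (`Literature/Analysis/Matrix/ConjugateGradientConvergence.lean`, `KrylovShiftedSystems.lean`)
in `Literature/Analysis/Matrix/DeflatedConjugateGradient.lean`, which imports this file.

## Sources (read on the materialised texts) and what is taken from each

* A. Frommer, K. Kahl, S. Krieg, B. Leder, M. Rottmann, *Adaptive aggregation based domain
  decomposition multigrid for the lattice Wilson–Dirac operator*, SIAM J. Sci. Comput. 36 (2014)
  A1581–A1608 = arXiv:1303.1377 [FrommerEtAl2013] (held text `paper:arxiv-1303.1377`):
  §4.1 eq. (4.1) (chunk p0013), restating M. Lüscher, JHEP 07 (2007) 081, §3 [Luscher2007]: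
  > Two projections `π_L`, `π_R` are defined in [Lüscher 2007] as follows
  > `π_L = I − D P D_c⁻¹ Pᴴ` and `π_R = I − P D_c⁻¹ Pᴴ D` (4.1).
  > Clearly `π_R` is the coarse grid correction …; [Lüscher 2007] uses these projections and the
  > relation `D π_R = π_L D` to decompose the linear system of equations `D z = b` as
  > `D π_R z = π_L b`, `D(I − π_R) z = (I − π_L) b`. The second equation can be simplified to
  > `(I − π_R) z = P D_c⁻¹ Pᴴ b`. Thus the solution `z` can be computed as
  > `z = π_R z + (I − π_R) z = χ + χ′`, where `χ′ = P D_c⁻¹ Pᴴ b` only requires the solution of the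
  > coarse grid system `D_c` and `D χ = D π_R χ = π_L b` is the "inexactly deflated" system
  (here `D_c = Pᴴ D P` is Lüscher's *little Dirac operator*, §3.1 ibid.; the columns of `P` span
  the deflation subspace) — §1–§3 below (`littleOp`, `coarseCorrection`, `piL`, `piR`,
  `D_mul_piR`, `piL_mul_piL`, `piR_mul_piR`, the kernels, `eq_piR_mulVec_add`,
  `D_mulVec_piR_mulVec`, `D_mulVec_piR_add_coarse`);
  §3.2 Definition 3.2, eq. (3.4) and **Lemma 3.3** (chunk p0010):
  > The aggregation is termed `Γ₅`-compatible if … This gives `Γ₅ P = P Γ₅ᶜ` (3.4) with `Γ₅ᶜ`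
  > acting as the identity on the spin-0-1-aggregates and as the negative identity on the
  > spin-2-3-aggregates. **Lemma 3.3.** Let the aggregation be `Γ₅`-compatible … and
  > `R = (Γ₅P)ᴴ`. Consider the two coarse grid operators `D_c^{PG} = R D P` and `D_c = Pᴴ D P`.
  > Then (i) `D_c = Γ₅ᶜ D_c^{PG}`. (ii) `I − P D_c⁻¹ Pᴴ D = I − P (D_c^{PG})⁻¹ R D`.
  > (iii) `D_c^{PG}` is hermitian, `D_c` is `Γ₅ᶜ`-symmetric. (iv) For the field of values we have
  > `𝓕(D_c) ⊆ 𝓕(D)`. *Proof.* … `Γ₅ᶜ = (Γ₅ᶜ)ᴴ = (Γ₅ᶜ)⁻¹` … `(D_c^{PG})ᴴ = PᴴDᴴRᴴ = PᴴDᴴΓ₅P =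
  > PᴴΓ₅DP = RDP` … since `PᴴP = I` …
  with the `Γ₅`-symmetry `(Γ₅ D)ᴴ = Γ₅ D` of §2.1/2.2 (chunk p0006–p0007) — §5 below.
* Y. Saad, M. Yeung, J. Erhel, F. Guyomarc'h, *A deflated version of the conjugate gradient
  algorithm*, SIAM J. Sci. Comput. 21 (2000) 1909–1926 [SaadEtAl2000] (held text
  `paper:doi-10-1137-s1064829598339761`, p. 1915): for `A` symmetric positive definite,
  > `H = I − W (WᵀAW)⁻¹ (AW)ᵀ` [is] the matrix of the `A`-orthogonal projection onto `W^{⊥_A}` and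
  > `Hᵀ = I − AW(WᵀAW)⁻¹Wᵀ` … These matrices satisfy the equality `AH = HᵀA = HᵀAH` (4.1)
  — i.e. `H = π_R`, `Hᵀ = π_L` for `D = A = Aᵀ`; §4 below (`conjTranspose_piR`,
  `mul_piR_eq_conjTranspose_mul_mul`, `isHermitian_mul_piR`, `posSemidef_mul_piR`).
* K. Kahl, H. Rittich, *The deflated conjugate gradient method: convergence, perturbation and
  accuracy*, Linear Algebra Appl. 515 (2017) 111–129 = arXiv:1209.1963 [KahlRittich2017]
  (held text `paper:arxiv-1209.1963`, chunk p0005), **Lemma 1**: with `π_A(𝒮) = V(V^*AV)⁻¹V^*A`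
  (`= I − π_R`), "`A(I − π_A(𝒮)) = (I − π_A(𝒮))^* A = (I − π_A(𝒮))^* A (I − π_A(𝒮))`; the matrix
  `A(I − π_A(𝒮))` is self-adjoint and positive semi-definite; the deflated system is consistent;
  if `x̂` is a solution of the deflated system then `(I − π_A)x̂ = (I − π_A)x`" and
  "`x = (I − π_A(𝒮)) x̂ + V (V^*AV)⁻¹ V^* b`" — §3–§4 below.

## What is formalised (all proved)

Over a commutative ring `R`: a square `D : Matrix n n R`, a *prolongation* `P : Matrix n k R`
(its columns span the deflation subspace / coarse space) and a *restriction* `Rs : Matrix k n R`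
(Lüscher, Kahl–Rittich, Saad et al.: `Rs = Pᴴ`; Frommer et al.'s Petrov–Galerkin choice
`Rs = (Γ₅P)ᴴ`), under the single hypothesis that the little operator `E = Rs D P` has invertible
determinant:
* §1 `littleOp`, `coarseCorrection = P E⁻¹ Rs`, `piL = 1 − D P E⁻¹ Rs`, `piR = 1 − P E⁻¹ Rs D`;
* §2 the projector calculus: `piL² = piL`, `piR² = piR`, `D piR = piL D`, `piL D P = 0`,
  `Rs piL = 0`, `piR P = 0`, `Rs D piR = 0`, `ker piR = range P`, `ker piL = range (D P)`, and for
  invertible `D`: `D⁻¹ = piR D⁻¹ + P E⁻¹ Rs`, `piR D⁻¹ = D⁻¹ piL`;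
* §3 the exact splitting of `D z = b` into the coarse part `(1 − piR) z = P E⁻¹ Rs b` and the
  deflated equation `D (piR z) = piL b`, and conversely the reconstruction of a solution of
  `D z = b` from ANY solution `χ` of the (singular, consistent) deflated equation
  `piL D χ = piL b`;
* §4 (star rings, `Rs = Pᴴ`): `piRᴴ = piL` for Hermitian `D`, `D piR = piRᴴ D piR` is Hermitian and,
  for `D` positive semidefinite over a star-ordered ring, positive semidefinite, with quadratic form
  `xᴴ(D piR)x = (piR x)ᴴ D (piR x)`;
* §5 `Γ`-compatible aggregation: from `(Γ D)ᴴ = Γ D`, `Γ = Γᴴ = Γ⁻¹`, `Γc = Γcᴴ = Γc⁻¹` and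
  `Γ P = P Γc`: Lemma 3.3 (i)–(iv) and the reality of `det (Pᴴ D P)`.

NOT here: anything about HOW the deflation subspace is built (local coherence, inverse iteration,
aggregates), solvers for the little system, or Krylov methods — the conjugate-gradient consequences
are in `Literature/Analysis/Matrix/DeflatedConjugateGradient.lean`.

## References
* [FrommerEtAl2013] A. Frommer, K. Kahl, S. Krieg, B. Leder, M. Rottmann, SIAM J. Sci.
  Comput. 36 (2014) A1581–A1608, arXiv:1303.1377: §2.2 (`Γ₅`-symmetry), Def. 3.2, eq. (3.4),
  Lemma 3.3; §4.1 eq. (4.1).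
* [Luscher2007] M. Lüscher, *Local coherence and deflation of the low quark modes in
  lattice QCD*, JHEP 07 (2007) 081, arXiv:0706.2298, §3 (cited through [FrommerEtAl2013,
  §4.1]).
* [SaadEtAl2000] Y. Saad, M. Yeung, J. Erhel, F. Guyomarc'h, SIAM J. Sci. Comput. 21
  (2000) 1909–1926, §4 eq. (4.1).
* [KahlRittich2017] K. Kahl, H. Rittich, Linear Algebra Appl. 515 (2017) 111–129, arXiv:1209.1963,
  §2 Lemma 1.
-/

noncomputable section

namespace Literature.LinearAlgebra.Matrix

namespace Deflation

open _root_.Matrix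

variable {R : Type*} [CommRing R]
variable {n k : Type*} [Fintype n] [Fintype k] [DecidableEq n] [DecidableEq k]

/-! ## §1 The little operator, the coarse correction and the two projectors -/

/-- **The little (coarse-grid) operator** `E = Rs D P` — Lüscher's "little Dirac operator"
`D_c = Pᴴ D P` when `Rs = Pᴴ`, Frommer et al.'s Petrov–Galerkin `D_c^{PG} = R D P`.
[cite: FrommerEtAl2013, §4.1 eq. (4.1) and Lemma 3.3 (`D_c = PᴴDP`, `D_c^{PG} = RDP`)] -/
def littleOp (D : Matrix n n R) (P : Matrix n k R) (Rs : Matrix k n R) : Matrix k k R := Rs * D * P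

/-- **The coarse-grid correction operator** `P E⁻¹ Rs` (`= I − π_R` composed with `D⁻¹` on the
coarse part: `χ′ = P D_c⁻¹ Pᴴ b`). [cite: FrommerEtAl2013, §4.1 (`χ′ = P D_c⁻¹ Pᴴ b`)] -/
def coarseCorrection (D : Matrix n n R) (P : Matrix n k R) (Rs : Matrix k n R) : Matrix n n R :=
  P * (littleOp D P Rs)⁻¹ * Rs

/-- **Lüscher's left projector** `π_L = I − D P D_c⁻¹ Rs`.
[cite: FrommerEtAl2013, §4.1 eq. (4.1)] -/
def piL (D : Matrix n n R) (P : Matrix n k R) (Rs : Matrix k n R) : Matrix n n R :=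
  1 - D * coarseCorrection D P Rs

/-- **Lüscher's right projector** `π_R = I − P D_c⁻¹ Rs D` ("the coarse grid correction").
[cite: FrommerEtAl2013, §4.1 eq. (4.1)] -/
def piR (D : Matrix n n R) (P : Matrix n k R) (Rs : Matrix k n R) : Matrix n n R :=
  1 - coarseCorrection D P Rs * D

section Algebra

variable {D : Matrix n n R} {P : Matrix n k R} {Rs : Matrix k n R}

omit [Fintype k] [DecidableEq n] [DecidableEq k] in
/-- Unfolding: `E = Rs D P`. [cite: FrommerEtAl2013, §4.1 eq. (4.1)] -/
theorem littleOp_eq : littleOp D P Rs = Rs * D * P := rfl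

/-- Unfolding: `1 − π_L = D P E⁻¹ Rs`. [cite: FrommerEtAl2013, §4.1 eq. (4.1)] -/
theorem one_sub_piL : 1 - piL D P Rs = D * coarseCorrection D P Rs := by
  rw [piL, sub_sub_cancel]

/-- Unfolding: `1 − π_R = P E⁻¹ Rs D`. [cite: FrommerEtAl2013, §4.1 eq. (4.1)] -/
theorem one_sub_piR : 1 - piR D P Rs = coarseCorrection D P Rs * D := by
  rw [piR, sub_sub_cancel]

omit [DecidableEq n] in
/-- `Rs D (P E⁻¹ Rs) = Rs`: the restriction does not see the coarse-corrected error.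
[cite: FrommerEtAl2013, §4.1 (the algebra behind `D π_R = π_L D`)] -/
theorem Rs_mul_D_mul_coarseCorrection (hE : IsUnit (littleOp D P Rs).det) :
    Rs * D * coarseCorrection D P Rs = Rs := by
  calc Rs * D * coarseCorrection D P Rs
      = littleOp D P Rs * (littleOp D P Rs)⁻¹ * Rs := by
        simp only [coarseCorrection, littleOp, Matrix.mul_assoc]
    _ = Rs := by rw [mul_nonsing_inv _ hE, Matrix.one_mul]

omit [DecidableEq n] in
/-- `(P E⁻¹ Rs) D P = P`: the coarse correction reproduces the coarse space exactly.
[cite: FrommerEtAl2013, §4.1 (the algebra behind `D π_R = π_L D`)] -/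
theorem coarseCorrection_mul_D_mul_P (hE : IsUnit (littleOp D P Rs).det) :
    coarseCorrection D P Rs * D * P = P := by
  calc coarseCorrection D P Rs * D * P
      = P * ((littleOp D P Rs)⁻¹ * littleOp D P Rs) := by
        simp only [coarseCorrection, littleOp, Matrix.mul_assoc]
    _ = P := by rw [nonsing_inv_mul _ hE, Matrix.mul_one]

omit [DecidableEq n] in
/-- `C D C = C` for the coarse correction `C = P E⁻¹ Rs`.
[cite: KahlRittich2017, §2 Lemma 1 (proof: "`(I − π_A(𝒮))` is a projection")] -/
theorem coarseCorrection_mul_D_mul_coarseCorrection (hE : IsUnit (littleOp D P Rs).det) :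
    coarseCorrection D P Rs * D * coarseCorrection D P Rs = coarseCorrection D P Rs := by
  calc coarseCorrection D P Rs * D * coarseCorrection D P Rs
      = coarseCorrection D P Rs * D * P * ((littleOp D P Rs)⁻¹ * Rs) := by
        simp only [coarseCorrection, Matrix.mul_assoc]
    _ = P * ((littleOp D P Rs)⁻¹ * Rs) := by rw [coarseCorrection_mul_D_mul_P hE]
    _ = coarseCorrection D P Rs := by simp only [coarseCorrection, Matrix.mul_assoc]

/-! ## §2 The projector calculus -/

/-- **`π_L² = π_L`.** [cite: FrommerEtAl2013, §4.1 ("two projections `π_L`, `π_R`")] -/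
theorem piL_mul_piL (hE : IsUnit (littleOp D P Rs).det) :
    piL D P Rs * piL D P Rs = piL D P Rs := by
  have h : D * coarseCorrection D P Rs * (D * coarseCorrection D P Rs) =
      D * coarseCorrection D P Rs := by
    calc D * coarseCorrection D P Rs * (D * coarseCorrection D P Rs)
        = D * (coarseCorrection D P Rs * D * coarseCorrection D P Rs) := by
          simp only [Matrix.mul_assoc]
      _ = D * coarseCorrection D P Rs := by rw [coarseCorrection_mul_D_mul_coarseCorrection hE]
  simp only [piL, sub_mul, mul_sub, Matrix.one_mul, Matrix.mul_one, h, sub_self, sub_zero]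

/-- **`π_R² = π_R`.** [cite: FrommerEtAl2013, §4.1 ("two projections `π_L`, `π_R`")] -/
theorem piR_mul_piR (hE : IsUnit (littleOp D P Rs).det) :
    piR D P Rs * piR D P Rs = piR D P Rs := by
  have h : coarseCorrection D P Rs * D * (coarseCorrection D P Rs * D) =
      coarseCorrection D P Rs * D := by
    calc coarseCorrection D P Rs * D * (coarseCorrection D P Rs * D)
        = coarseCorrection D P Rs * D * coarseCorrection D P Rs * D := by
          simp only [Matrix.mul_assoc]
      _ = coarseCorrection D P Rs * D := by rw [coarseCorrection_mul_D_mul_coarseCorrection hE]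
  simp only [piR, sub_mul, mul_sub, Matrix.one_mul, Matrix.mul_one, h, sub_self, sub_zero]

/-- **`D π_R = π_L D`** (no hypothesis needed). [cite: FrommerEtAl2013, §4.1
("the relation `D π_R = π_L D`"); SaadEtAl2000, §4 eq. (4.1) (`AH = HᵀA`)] -/
theorem D_mul_piR : D * piR D P Rs = piL D P Rs * D := by
  simp only [piR, piL, mul_sub, sub_mul, Matrix.mul_one, Matrix.one_mul, Matrix.mul_assoc]

/-- **`π_L D P = 0`**: `π_L` annihilates `D` applied to the deflation subspace.
[cite: FrommerEtAl2013, §4.1 eq. (4.1)] -/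
theorem piL_mul_D_mul_P (hE : IsUnit (littleOp D P Rs).det) : piL D P Rs * (D * P) = 0 := by
  have h : D * coarseCorrection D P Rs * (D * P) = D * P := by
    calc D * coarseCorrection D P Rs * (D * P) = D * (coarseCorrection D P Rs * D * P) := by
          simp only [Matrix.mul_assoc]
      _ = D * P := by rw [coarseCorrection_mul_D_mul_P hE]
  rw [piL, Matrix.sub_mul, Matrix.one_mul, h, sub_self]

/-- **`Rs π_L = 0`**: the range of `π_L` is invisible to the restriction (for `Rs = Pᴴ`: orthogonal
to the deflation subspace — "`P_L ρ = ρ` … is therefore orthogonal to the deflation subspace").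
[cite: FrommerEtAl2013, §4.1 eq. (4.1); Luscher2007, §6.2] -/
theorem Rs_mul_piL (hE : IsUnit (littleOp D P Rs).det) : Rs * piL D P Rs = 0 := by
  have h : Rs * (D * coarseCorrection D P Rs) = Rs := by
    rw [← Matrix.mul_assoc, Rs_mul_D_mul_coarseCorrection hE]
  rw [piL, Matrix.mul_sub, Matrix.mul_one, h, sub_self]

/-- **`π_R P = 0`**: `π_R` annihilates the deflation subspace.
[cite: FrommerEtAl2013, §4.1 eq. (4.1); KahlRittich2017, §3.1 ("the kernel of
`(I − π_A(𝒮))` … is the deflation subspace `𝒮`")] -/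
theorem piR_mul_P (hE : IsUnit (littleOp D P Rs).det) : piR D P Rs * P = 0 := by
  rw [piR, Matrix.sub_mul, Matrix.one_mul, coarseCorrection_mul_D_mul_P hE, sub_self]

/-- **`Rs D π_R = 0`.** [cite: FrommerEtAl2013, §4.1 eq. (4.1); SaadEtAl2000,
§2 ("noting that `WᵀB = 0`", `B = A − AW(WᵀAW)⁻¹WᵀA = A H`)] -/
theorem Rs_mul_D_mul_piR (hE : IsUnit (littleOp D P Rs).det) : Rs * D * piR D P Rs = 0 := by
  rw [Matrix.mul_assoc, D_mul_piR, ← Matrix.mul_assoc, Rs_mul_piL hE, Matrix.zero_mul]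

/-- **`ker π_R = range P`**: `π_R x = 0` iff `x` lies in the deflation subspace (the column space
of `P`). [cite: KahlRittich2017, §3.1 ("the kernel of `(I − π_A(𝒮))` which is the deflation
subspace `𝒮`")] -/
theorem piR_mulVec_eq_zero_iff (hE : IsUnit (littleOp D P Rs).det) (x : n → R) :
    piR D P Rs *ᵥ x = 0 ↔ ∃ y : k → R, P *ᵥ y = x := by
  constructor
  · intro h
    refine ⟨((littleOp D P Rs)⁻¹ * Rs * D) *ᵥ x, ?_⟩
    have h1 : (1 - piR D P Rs) *ᵥ x = x := by rw [sub_mulVec, one_mulVec, h, sub_zero]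
    rw [one_sub_piR, coarseCorrection] at h1
    rw [mulVec_mulVec]
    simpa only [Matrix.mul_assoc] using h1
  · rintro ⟨y, rfl⟩
    rw [mulVec_mulVec, piR_mul_P hE, zero_mulVec]

/-- **`ker π_L = range (D P)`**: `π_L x = 0` iff `x = D P y` for some coarse vector `y`.
[cite: FrommerEtAl2013, §4.1 (`D(I − π_R) z = (I − π_L) b`)] -/
theorem piL_mulVec_eq_zero_iff (hE : IsUnit (littleOp D P Rs).det) (x : n → R) :
    piL D P Rs *ᵥ x = 0 ↔ ∃ y : k → R, (D * P) *ᵥ y = x := by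
  constructor
  · intro h
    refine ⟨((littleOp D P Rs)⁻¹ * Rs) *ᵥ x, ?_⟩
    have h1 : (1 - piL D P Rs) *ᵥ x = x := by rw [sub_mulVec, one_mulVec, h, sub_zero]
    rw [one_sub_piL, coarseCorrection] at h1
    rw [mulVec_mulVec]
    simpa only [Matrix.mul_assoc] using h1
  · rintro ⟨y, rfl⟩
    rw [mulVec_mulVec, piL_mul_D_mul_P hE, zero_mulVec]

/-- **`π_L` fixes every vector the restriction does not see**: `Rs x = 0 ⇒ π_L x = x` (for
`Rs = Pᴴ`: `π_L` is the identity on the orthogonal complement of the deflation subspace).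
[cite: Luscher2007, §6.2 ("`P_L ρ = ρ` by construction and is therefore orthogonal to
the deflation subspace"); FrommerEtAl2013, §4.1 eq. (4.1)] -/
theorem piL_mulVec_of_Rs_mulVec_eq_zero {x : n → R} (hx : Rs *ᵥ x = 0) :
    piL D P Rs *ᵥ x = x := by
  rw [piL, sub_mulVec, one_mulVec, coarseCorrection]
  simp only [← mulVec_mulVec, hx, mulVec_zero, sub_zero]

/-- **`π_R` fixes every `x` with `Rs D x = 0`.** [cite: FrommerEtAl2013, §4.1
eq. (4.1)] -/
theorem piR_mulVec_of_Rs_D_mulVec_eq_zero {x : n → R} (hx : Rs *ᵥ (D *ᵥ x) = 0) :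
    piR D P Rs *ᵥ x = x := by
  rw [piR, sub_mulVec, one_mulVec, coarseCorrection]
  simp only [← mulVec_mulVec, hx, mulVec_zero, sub_zero]

/-- The range of `π_L` is annihilated by the restriction: `Rs (π_L x) = 0`.
[cite: Luscher2007, §6.2; FrommerEtAl2013, §4.1 eq. (4.1)] -/
theorem Rs_mulVec_piL_mulVec (hE : IsUnit (littleOp D P Rs).det) (x : n → R) :
    Rs *ᵥ (piL D P Rs *ᵥ x) = 0 := by
  rw [mulVec_mulVec, Rs_mul_piL hE, zero_mulVec]

/-- The range of `π_R` satisfies the Petrov–Galerkin condition `Rs D (π_R x) = 0`.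
[cite: SaadEtAl2000, §2 (`WᵀB = 0`); FrommerEtAl2013, §4.1 eq. (4.1)] -/
theorem Rs_D_mulVec_piR_mulVec (hE : IsUnit (littleOp D P Rs).det) (x : n → R) :
    Rs *ᵥ (D *ᵥ (piR D P Rs *ᵥ x)) = 0 := by
  rw [mulVec_mulVec, mulVec_mulVec, Rs_mul_D_mul_piR hE, zero_mulVec]

/-- **Decomposition of the inverse**: `D⁻¹ = π_R D⁻¹ + P E⁻¹ Rs` — the low-mode (coarse) part of
`D⁻¹` is obtained exactly from the little operator. [cite: FrommerEtAl2013, §4.1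
(`z = π_R z + (I − π_R) z = χ + χ′`, `χ′ = P D_c⁻¹ Pᴴ b`)] -/
theorem inv_eq_piR_mul_inv_add (hD : IsUnit D.det) :
    D⁻¹ = piR D P Rs * D⁻¹ + coarseCorrection D P Rs := by
  rw [piR, sub_mul, Matrix.one_mul, Matrix.mul_assoc, mul_nonsing_inv _ hD, Matrix.mul_one,
    sub_add_cancel]

/-- **`π_R D⁻¹ = D⁻¹ π_L`.** [cite: FrommerEtAl2013, §4.1 (`D π_R = π_L D`)] -/
theorem piR_mul_inv (hD : IsUnit D.det) : piR D P Rs * D⁻¹ = D⁻¹ * piL D P Rs := by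
  rw [piR, piL, sub_mul, mul_sub, Matrix.one_mul, Matrix.mul_one, Matrix.mul_assoc,
    mul_nonsing_inv _ hD, Matrix.mul_one, ← Matrix.mul_assoc, nonsing_inv_mul _ hD,
    Matrix.one_mul]

/-! ## §3 The exact splitting of `D z = b` -/

/-- **Coarse part of the solution**: if `D z = b` then `(1 − π_R) z = P E⁻¹ Rs b`, i.e.
`z = π_R z + P E⁻¹ Rs b` ("`(I − π_R) z = P D_c⁻¹ Pᴴ b` … `z = χ + χ′`").
[cite: FrommerEtAl2013, §4.1; KahlRittich2017, §2 eq. (2.3) with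
"`x = (I − π_A(𝒮)) x̂ + V (V^*AV)⁻¹ V^* b`"] -/
theorem eq_piR_mulVec_add {z b : n → R} (hz : D *ᵥ z = b) :
    z = piR D P Rs *ᵥ z + coarseCorrection D P Rs *ᵥ b := by
  rw [piR, sub_mulVec, one_mulVec, ← mulVec_mulVec, hz, sub_add_cancel]

/-- **The deflated equation**: if `D z = b` then `χ = π_R z` solves `D χ = π_L b`.
[cite: FrommerEtAl2013, §4.1 (`D χ = D π_R χ = π_L b`)] -/
theorem D_mulVec_piR_mulVec {z b : n → R} (hz : D *ᵥ z = b) :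
    D *ᵥ (piR D P Rs *ᵥ z) = piL D P Rs *ᵥ b := by
  rw [mulVec_mulVec, D_mul_piR, ← mulVec_mulVec, hz]

/-- **Reconstruction from the deflated equation** (Lüscher's `χ(x) = P_R ψ(x)`, eq. (3.11) as
restated): if `χ` solves the — singular but consistent — projected equation `π_L D χ = π_L b`
(in particular if `D χ = π_L b`), then `z = π_R χ + P E⁻¹ Rs b` solves `D z = b`.
[cite: FrommerEtAl2013, §4.1; Luscher2007, §6.1 ("the solution of eq. (3.11)
is then given by `χ = P_R M φ`"); KahlRittich2017, §2 Lemma 1 (iii)–(iv)] -/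
theorem D_mulVec_piR_add_coarse {χ b : n → R}
    (hχ : piL D P Rs *ᵥ (D *ᵥ χ) = piL D P Rs *ᵥ b) :
    D *ᵥ (piR D P Rs *ᵥ χ + coarseCorrection D P Rs *ᵥ b) = b := by
  have h1 : D *ᵥ (piR D P Rs *ᵥ χ) = piL D P Rs *ᵥ b := by
    rw [mulVec_mulVec, D_mul_piR, ← mulVec_mulVec, hχ]
  have h2 : D *ᵥ (coarseCorrection D P Rs *ᵥ b) = (1 - piL D P Rs) *ᵥ b := by
    rw [mulVec_mulVec, one_sub_piL]
  rw [mulVec_add, h1, h2, sub_mulVec, one_mulVec, add_sub_cancel]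

/-- A solution of `D χ = π_L b` solves the projected equation `π_L D χ = π_L b`.
[cite: KahlRittich2017, §2 Lemma 1 (iii) (consistency)] -/
theorem piL_D_mulVec_of_D_mulVec (hE : IsUnit (littleOp D P Rs).det) {χ b : n → R}
    (hχ : D *ᵥ χ = piL D P Rs *ᵥ b) :
    piL D P Rs *ᵥ (D *ᵥ χ) = piL D P Rs *ᵥ b := by
  rw [hχ, mulVec_mulVec, piL_mul_piL hE]

/-- **The deflated equation determines `π_R χ`**: two solutions of `π_L D χ = π_L b` differ by an
element of the deflation subspace when `D` is invertible ("`(I − π_A)x̂ = (I − π_A)x`").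
[cite: KahlRittich2017, §2 Lemma 1 (iv)] -/
theorem piR_mulVec_eq_of_deflated (hD : IsUnit D.det)
    {χ χ' b : n → R} (hχ : piL D P Rs *ᵥ (D *ᵥ χ) = piL D P Rs *ᵥ b)
    (hχ' : piL D P Rs *ᵥ (D *ᵥ χ') = piL D P Rs *ᵥ b) :
    piR D P Rs *ᵥ χ = piR D P Rs *ᵥ χ' := by
  have key : ∀ ψ : n → R, piR D P Rs *ᵥ ψ = D⁻¹ *ᵥ (piL D P Rs *ᵥ (D *ᵥ ψ)) := by
    intro ψ
    rw [mulVec_mulVec, mulVec_mulVec, ← piR_mul_inv hD, Matrix.mul_assoc, nonsing_inv_mul _ hD,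
      Matrix.mul_one]
  rw [key χ, key χ', hχ, hχ']

end Algebra

/-! ## §4 Hermitian systems: `π_Rᴴ = π_L`, and `D π_R` is Hermitian positive semidefinite -/

section Star

variable [StarRing R] {D : Matrix n n R} {P : Matrix n k R} {Rs : Matrix k n R}

omit [Fintype k] [DecidableEq n] [DecidableEq k] in
/-- `(Rs D P)ᴴ = Pᴴ Dᴴ Rsᴴ` is the little operator of the adjoint data.
[cite: FrommerEtAl2013, Lemma 3.3 (proof, `(D_c^{PG})ᴴ = PᴴDᴴRᴴ`)] -/
theorem conjTranspose_littleOp : (littleOp D P Rs)ᴴ = littleOp Dᴴ Rsᴴ Pᴴ := by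
  simp only [littleOp, conjTranspose_mul, Matrix.mul_assoc]

omit [DecidableEq n] in
/-- `(P E⁻¹ Rs)ᴴ = Rsᴴ (Eᴴ)⁻¹ Pᴴ`. [cite: SaadEtAl2000, §4 (the pair `H`, `Hᵀ`)] -/
theorem conjTranspose_coarseCorrection :
    (coarseCorrection D P Rs)ᴴ = coarseCorrection Dᴴ Rsᴴ Pᴴ := by
  simp only [coarseCorrection, conjTranspose_mul, conjTranspose_nonsing_inv,
    conjTranspose_littleOp, Matrix.mul_assoc]

/-- **`π_R(D)ᴴ = π_L(Dᴴ)`** with prolongation and restriction exchanged and adjointed.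
[cite: SaadEtAl2000, §4 (`H = I − W(WᵀAW)⁻¹(AW)ᵀ`, `Hᵀ = I − AW(WᵀAW)⁻¹Wᵀ`)] -/
theorem conjTranspose_piR : (piR D P Rs)ᴴ = piL Dᴴ Rsᴴ Pᴴ := by
  rw [piR, piL, conjTranspose_sub, conjTranspose_one, conjTranspose_mul,
    conjTranspose_coarseCorrection]

/-- **`π_L(D)ᴴ = π_R(Dᴴ)`.** [cite: SaadEtAl2000, §4 (`H`, `Hᵀ`)] -/
theorem conjTranspose_piL : (piL D P Rs)ᴴ = piR Dᴴ Rsᴴ Pᴴ := by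
  rw [piR, piL, conjTranspose_sub, conjTranspose_one, conjTranspose_mul,
    conjTranspose_coarseCorrection]

/-- For Hermitian `D` and `Rs = Pᴴ`: **`π_Rᴴ = π_L`** (`Hᵀ` is the transpose of `H`;
`(I − π_A(𝒮))^*`). [cite: SaadEtAl2000, §4 eq. (4.1); KahlRittich2017, §2 Lemma 1 (i)] -/
theorem conjTranspose_piR_of_isHermitian (hD : D.IsHermitian) :
    (piR D P Pᴴ)ᴴ = piL D P Pᴴ := by
  rw [conjTranspose_piR, conjTranspose_conjTranspose, hD.eq]

/-- **`A H = Hᵀ A H`**: for Hermitian `D`, `D π_R = π_Rᴴ D π_R`.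
[cite: SaadEtAl2000, §4 eq. (4.1); KahlRittich2017, §2 Lemma 1 (i) eq. (2.6)] -/
theorem mul_piR_eq_conjTranspose_mul_mul (hE : IsUnit (littleOp D P Pᴴ).det) (hD : D.IsHermitian) :
    D * piR D P Pᴴ = (piR D P Pᴴ)ᴴ * D * piR D P Pᴴ := by
  rw [conjTranspose_piR_of_isHermitian hD, Matrix.mul_assoc, D_mul_piR, ← Matrix.mul_assoc,
    piL_mul_piL hE]

/-- **The deflated matrix `D π_R` is Hermitian** for Hermitian `D`.
[cite: KahlRittich2017, §2 Lemma 1 (ii); SaadEtAl2000, §2 ("the matrix `B` is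
symmetric")] -/
theorem isHermitian_mul_piR (hE : IsUnit (littleOp D P Pᴴ).det) (hD : D.IsHermitian) :
    (D * piR D P Pᴴ).IsHermitian := by
  rw [mul_piR_eq_conjTranspose_mul_mul hE hD]
  exact isHermitian_conjTranspose_mul_mul _ hD

/-- **The quadratic form of the deflated matrix**: `xᴴ (D π_R) x = (π_R x)ᴴ D (π_R x)`
("`⟨A(I − π_A)x, x⟩ = ‖(I − π_A)x‖_A²`"). [cite: KahlRittich2017, §2 Lemma 1 (proof of (ii))] -/
theorem star_dotProduct_mul_piR_mulVec (hE : IsUnit (littleOp D P Pᴴ).det) (hD : D.IsHermitian)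
    (x : n → R) :
    star x ⬝ᵥ (D * piR D P Pᴴ) *ᵥ x =
      star (piR D P Pᴴ *ᵥ x) ⬝ᵥ D *ᵥ (piR D P Pᴴ *ᵥ x) := by
  rw [mul_piR_eq_conjTranspose_mul_mul hE hD, ← mulVec_mulVec, ← mulVec_mulVec,
    dotProduct_mulVec, ← star_mulVec]

/-- **The deflated matrix is positive semidefinite** when `D` is ("`A(I − π_A(𝒮))` is
self-adjoint and positive semi-definite"). [cite: KahlRittich2017, §2 Lemma 1 (ii)] -/
theorem posSemidef_mul_piR [PartialOrder R] [StarOrderedRing R]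
    (hE : IsUnit (littleOp D P Pᴴ).det) (hD : D.PosSemidef) :
    (D * piR D P Pᴴ).PosSemidef := by
  rw [mul_piR_eq_conjTranspose_mul_mul hE hD.1]
  exact hD.conjTranspose_mul_mul_same _

end Star

/-! ## §5 `Γ`-compatible aggregation: the coarse operator inherits the `Γ`-symmetry
(Frommer–Kahl–Krieg–Leder–Rottmann, Lemma 3.3) -/

section Gamma

variable [StarRing R] {D Γ : Matrix n n R} {P : Matrix n k R} {Γc : Matrix k k R}

omit [DecidableEq n] in
/-- `Γ`-symmetry `(Γ D)ᴴ = Γ D` in the form `Dᴴ Γ = Γ D` (for `Γᴴ = Γ`).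
[cite: FrommerEtAl2013, §2.2 eq. (2.11) (`(Γ₅ D)ᴴ = Γ₅ D`)] -/
theorem conjTranspose_mul_gamma (hΓ : Γᴴ = Γ) (hD : (Γ * D)ᴴ = Γ * D) : Dᴴ * Γ = Γ * D := by
  rw [conjTranspose_mul, hΓ] at hD
  exact hD

/-- `Γ`-symmetry in conjugation form: `Dᴴ = Γ D Γ` when `Γ² = 1`, `Γᴴ = Γ` ("`Dᴴ = Γ₅ D Γ₅`").
[cite: FrommerEtAl2013, Lemma 2.1 (proof: "Due to `Dᴴ = Γ₅ D Γ₅`")] -/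
theorem conjTranspose_eq_gamma_mul_mul_gamma (hΓ : Γᴴ = Γ) (hΓ2 : Γ * Γ = 1)
    (hD : (Γ * D)ᴴ = Γ * D) : Dᴴ = Γ * D * Γ := by
  rw [← conjTranspose_mul_gamma hΓ hD, Matrix.mul_assoc, hΓ2, Matrix.mul_one]

/-- Bridge to the tree's convention `Dᴴ = Γ D Γ⁻¹` of
`Literature.MathematicalPhysics.QuantumFieldTheory.GammaHermiticity` (an involution is its own
inverse). [cite: FrommerEtAl2013, Lemma 2.1 (proof: "`Dᴴ = Γ₅ D Γ₅`")] -/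
theorem conjTranspose_eq_gamma_mul_mul_inv (hΓ : Γᴴ = Γ) (hΓ2 : Γ * Γ = 1)
    (hD : (Γ * D)ᴴ = Γ * D) : Dᴴ = Γ * D * Γ⁻¹ := by
  rw [inv_eq_left_inv hΓ2]
  exact conjTranspose_eq_gamma_mul_mul_gamma hΓ hΓ2 hD

omit [DecidableEq n] in
/-- **Lemma 3.3 (i)**: with a `Γ`-compatible prolongation (`Γ P = P Γc`) and the Petrov–Galerkin
restriction `R = (Γ P)ᴴ`, the two coarse operators differ by `Γc`: `Pᴴ D P = Γc (R D P)`.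
[cite: FrommerEtAl2013, Lemma 3.3 (i)] -/
theorem galerkin_eq_gammaC_mul_petrovGalerkin (hΓc : Γcᴴ = Γc) (hΓc2 : Γc * Γc = 1)
    (hcompat : Γ * P = P * Γc) :
    littleOp D P Pᴴ = Γc * littleOp D P (Γ * P)ᴴ := by
  rw [littleOp, littleOp, hcompat, conjTranspose_mul, hΓc,
    show Γc * (Γc * Pᴴ * D * P) = Γc * Γc * Pᴴ * D * P by simp only [Matrix.mul_assoc], hΓc2,
    Matrix.one_mul]

omit [DecidableEq n] [DecidableEq k] in
/-- **Lemma 3.3 (i)**, as printed: `D_c^{PG} = R D P = Γc D_c`.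
[cite: FrommerEtAl2013, Lemma 3.3 (i) (proof: `RDP = … = Γ₅ᶜ PᴴDP = Γ₅ᶜ D_c`)] -/
theorem petrovGalerkin_eq_gammaC_mul_galerkin (hΓc : Γcᴴ = Γc) (hcompat : Γ * P = P * Γc) :
    littleOp D P (Γ * P)ᴴ = Γc * littleOp D P Pᴴ := by
  rw [littleOp, littleOp, hcompat, conjTranspose_mul, hΓc]
  simp only [Matrix.mul_assoc]

omit [Fintype k] [DecidableEq n] [DecidableEq k] in
/-- **Lemma 3.3 (iii), first half**: the Petrov–Galerkin coarse operator `R D P`, `R = (Γ P)ᴴ`, is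
Hermitian whenever `Γ D` is. [cite: FrommerEtAl2013, Lemma 3.3 (iii)
(proof: `(D_c^{PG})ᴴ = PᴴDᴴRᴴ = PᴴDᴴΓ₅P = PᴴΓ₅DP = RDP`)] -/
theorem isHermitian_petrovGalerkin (hΓ : Γᴴ = Γ) (hD : (Γ * D)ᴴ = Γ * D) :
    (littleOp D P (Γ * P)ᴴ).IsHermitian := by
  change ((Γ * P)ᴴ * D * P)ᴴ = (Γ * P)ᴴ * D * P
  rw [conjTranspose_mul, conjTranspose_mul, conjTranspose_conjTranspose, conjTranspose_mul, hΓ,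
    ← Matrix.mul_assoc Dᴴ Γ P, conjTranspose_mul_gamma hΓ hD]
  simp only [Matrix.mul_assoc]

omit [DecidableEq n] in
/-- **Lemma 3.3 (iii), second half**: the Galerkin coarse operator `D_c = Pᴴ D P` is
`Γc`-symmetric, `(Γc D_c)ᴴ = Γc D_c` — the coarse system has the structure of the fine one, so the
construction can be applied recursively. [cite: FrommerEtAl2013, Lemma 3.3 (iii)] -/
theorem gammaC_symmetric_galerkin (hΓ : Γᴴ = Γ) (hΓc : Γcᴴ = Γc) (hΓc2 : Γc * Γc = 1)
    (hcompat : Γ * P = P * Γc) (hD : (Γ * D)ᴴ = Γ * D) :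
    (Γc * littleOp D P Pᴴ)ᴴ = Γc * littleOp D P Pᴴ := by
  have h : Γc * littleOp D P Pᴴ = littleOp D P (Γ * P)ᴴ := by
    rw [galerkin_eq_gammaC_mul_petrovGalerkin hΓc hΓc2 hcompat, ← Matrix.mul_assoc, hΓc2,
      Matrix.one_mul]
  rw [h]
  exact (isHermitian_petrovGalerkin hΓ hD).eq

omit [DecidableEq n] in
/-- `Γc`-symmetry of `D_c = Pᴴ D P` in conjugation form, `D_cᴴ = Γc D_c Γc`.
[cite: FrommerEtAl2013, Lemma 3.3 (iii)] -/
theorem conjTranspose_galerkin (hΓ : Γᴴ = Γ) (hΓc : Γcᴴ = Γc) (hΓc2 : Γc * Γc = 1)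
    (hcompat : Γ * P = P * Γc) (hD : (Γ * D)ᴴ = Γ * D) :
    (littleOp D P Pᴴ)ᴴ = Γc * littleOp D P Pᴴ * Γc :=
  conjTranspose_eq_gamma_mul_mul_gamma hΓc hΓc2 (gammaC_symmetric_galerkin hΓ hΓc hΓc2 hcompat hD)

omit [DecidableEq n] in
/-- `Γc`-symmetry of `D_c = Pᴴ D P` in the tree's `GammaHermiticity` convention
`D_cᴴ = Γc D_c Γc⁻¹` (so, over `ℂ`, `det D_c` is real and the spectrum of `D_c` is closed under
complex conjugation by `GammaHermiticity.star_det_eq_det` / `mem_spectrum_conj_iff`).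
[cite: FrommerEtAl2013, Lemma 3.3 (iii) with Lemma 2.1] -/
theorem conjTranspose_galerkin' (hΓ : Γᴴ = Γ) (hΓc : Γcᴴ = Γc) (hΓc2 : Γc * Γc = 1)
    (hcompat : Γ * P = P * Γc) (hD : (Γ * D)ᴴ = Γ * D) :
    (littleOp D P Pᴴ)ᴴ = Γc * littleOp D P Pᴴ * Γc⁻¹ :=
  conjTranspose_eq_gamma_mul_mul_inv hΓc hΓc2 (gammaC_symmetric_galerkin hΓ hΓc hΓc2 hcompat hD)

omit [DecidableEq n] in
/-- **The determinant of a `Γ`-symmetric coarse operator is real**: `star (det D_c) = det D_c`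
(taking determinants in `D_cᴴ = Γc D_c Γc`, `det Γc² = 1`).
[cite: FrommerEtAl2013, Lemma 3.3 (iii) with Lemma 2.1 (symmetry of the spectrum)] -/
theorem star_det_galerkin (hΓ : Γᴴ = Γ) (hΓc : Γcᴴ = Γc) (hΓc2 : Γc * Γc = 1)
    (hcompat : Γ * P = P * Γc) (hD : (Γ * D)ᴴ = Γ * D) :
    star (littleOp D P Pᴴ).det = (littleOp D P Pᴴ).det := by
  have h := congrArg Matrix.det (conjTranspose_galerkin hΓ hΓc hΓc2 hcompat hD)
  rw [det_conjTranspose, det_mul, det_mul] at h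
  have hdet : Γc.det * Γc.det = 1 := by rw [← det_mul, hΓc2, det_one]
  rw [h, mul_comm Γc.det _, mul_assoc, hdet, mul_one]

omit [DecidableEq n] in
/-- **Lemma 3.3 (ii)**: the Galerkin and the Petrov–Galerkin coarse-grid corrections coincide,
`P D_c⁻¹ Pᴴ D = P (D_c^{PG})⁻¹ R D` — i.e. `π_R` is the same for both restrictions.
[cite: FrommerEtAl2013, Lemma 3.3 (ii)] -/
theorem coarseCorrection_petrovGalerkin_eq (hΓc : Γcᴴ = Γc) (hΓc2 : Γc * Γc = 1)
    (hcompat : Γ * P = P * Γc) :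
    coarseCorrection D P (Γ * P)ᴴ = coarseCorrection D P Pᴴ := by
  have hΓcinv : Γc⁻¹ = Γc := inv_eq_left_inv hΓc2
  rw [coarseCorrection, coarseCorrection, petrovGalerkin_eq_gammaC_mul_galerkin hΓc hcompat,
    Matrix.mul_inv_rev, hΓcinv, hcompat, conjTranspose_mul, hΓc]
  calc P * ((littleOp D P Pᴴ)⁻¹ * Γc) * (Γc * Pᴴ)
      = P * (littleOp D P Pᴴ)⁻¹ * (Γc * Γc) * Pᴴ := by simp only [Matrix.mul_assoc]
    _ = P * (littleOp D P Pᴴ)⁻¹ * Pᴴ := by rw [hΓc2, Matrix.mul_one]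

/-- **Lemma 3.3 (ii)** for the projectors: `π_R` built with `R = (ΓP)ᴴ` equals `π_R` built with
`Pᴴ`. [cite: FrommerEtAl2013, Lemma 3.3 (ii)] -/
theorem piR_petrovGalerkin_eq (hΓc : Γcᴴ = Γc) (hΓc2 : Γc * Γc = 1) (hcompat : Γ * P = P * Γc) :
    piR D P (Γ * P)ᴴ = piR D P Pᴴ := by
  rw [piR, piR, coarseCorrection_petrovGalerkin_eq hΓc hΓc2 hcompat]

/-- Same for `π_L`. [cite: FrommerEtAl2013, Lemma 3.3 (ii)] -/
theorem piL_petrovGalerkin_eq (hΓc : Γcᴴ = Γc) (hΓc2 : Γc * Γc = 1) (hcompat : Γ * P = P * Γc) :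
    piL D P (Γ * P)ᴴ = piL D P Pᴴ := by
  rw [piL, piL, coarseCorrection_petrovGalerkin_eq hΓc hΓc2 hcompat]

omit [DecidableEq n] [DecidableEq k] in
/-- **Lemma 3.3 (iv)**, `𝓕(D_c) ⊆ 𝓕(D)`: for a prolongation with orthonormal columns
(`Pᴴ P = 1`) every Rayleigh quotient of `D_c = Pᴴ D P` is a Rayleigh quotient of `D` at a vector of
the same norm, namely `φ = P ψ`. [cite: FrommerEtAl2013, Lemma 3.3 (iv)] -/
theorem fieldOfValues_galerkin [DecidableEq k] (hP : Pᴴ * P = 1) (ψ : k → R) :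
    star (P *ᵥ ψ) ⬝ᵥ (P *ᵥ ψ) = star ψ ⬝ᵥ ψ ∧
      star (P *ᵥ ψ) ⬝ᵥ D *ᵥ (P *ᵥ ψ) = star ψ ⬝ᵥ littleOp D P Pᴴ *ᵥ ψ := by
  constructor
  · rw [star_mulVec, ← dotProduct_mulVec, mulVec_mulVec, hP, one_mulVec]
  · rw [star_mulVec, ← dotProduct_mulVec, mulVec_mulVec, mulVec_mulVec, littleOp]

end Gamma

end Deflation

end Literature.LinearAlgebra.Matrix

end
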